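import Literature.Probability.RandomPlanarGeometry.HullRestrictionSLE
import Literature.Probability.RandomPlanarGeometry.RestrictionUniqueness
import Literature.Probability.RandomPlanarGeometry.HalfPlaneFillProofs
import Literature.Probability.RandomPlanarGeometry.JordanDomainProofs
import Literature.Probability.RandomPlanarGeometry.ConformalMapRiemannProofs
import Literature.Probability.RandomPlanarGeometry.CaratheodoryExtension
import Literature.Topology.PlaneTopology.JordanCurveProofs
import Literature.Topology.PlaneTopology.EilenbergCriterion
import HarnessLib

/-!
# `Literature.Probability.RandomPlanarGeometry.LawlerSchrammWerner2003` from the leaf literature facts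

Proof-only file: the final assembly of the named fact `Literature.Probability.RandomPlanarGeometry.LawlerSchrammWerner2003`
(`ConformalRestriction`: [LSW] p. 5 result 2 transposed to chordal curve families on Dobrushin
domains) from

* the transposed restriction property of SLE_{8/3}
  (`IsSLELaw.hullRestriction_eightThirds_of_facts`, `HullRestrictionSLE`: [LSW] Thm. 6.1), and
* the uniqueness half (`LawlerSchrammWerner2003_unique_of_facts`, `RestrictionUniqueness`:
  [LSW] Prop. 3.3, Lemma 2.1, Thm. 7.3 / Cor. 8.6),

with the classical inputs that the tree PROVES discharged: the Jordan curve theorem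
(`JordanCurveTheorem_holds`), arc non-separation (`JordanArcSeparation_holds`), simple
connectivity of Jordan domains (`JordanDomain.isSimplyConnected_holds`), the Riemann
mapping theorem (`exists_conformalEquiv_ball_holds`), Conway VIII.2.2
(`isSimplyConnected_of_isConnected_compl_holds`) and Carathéodory's theorem for Jordan domains
(Pommerenke Thm. 2.6: `JordanDomain.exists_continuousOn_extension_of_jordanCurveTheorem`).

What remains hypothetical in `LawlerSchrammWerner2003_of_leaf_facts` is exactly a list of NAMED
literature facts, each vendored with its citation: Kolmogorov extension for the Wiener measure
(`hW`), existence of the SLE trace (`h8`, `hne`: Rohde–Schramm Thm. 5.1, Lawler–Schramm–Werner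
for `κ = 8`), its transience (`htr`: RS Thm. 7.1) and simplicity for `κ ≤ 4` (`h₆`: RS
Thm. 6.1), Brownian scaling of the trace (`hscale`), and from [LSW]: Thm. 6.1 verbatim (`h61`),
`Φ_A` and `Φ'_A(0)`
(`hexΦ`, `hex`: §2 with (2.4)), continuity of `Φ'_A(0)` under exhaustion (`hFc`: Lemma 3.5 +
kernel theorem), Lemma 2.1 with the Lemma 3.5 convergence (`h21`), the `±`-factorisation
(`hfac`: §2 p. 8), Prop. 3.3 (1) ⇒ (3) (`h33`) and p. 5 result 2, first sentence (`h58`: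
Thm. 7.3, Cor. 8.6).

* G. F. Lawler, O. Schramm, W. Werner, *Conformal restriction: the chordal case*, J. Amer.
  Math. Soc. **16** (2003) 917–955, arXiv:math/0209343.
-/

noncomputable section

open scoped NNReal

namespace Literature.Probability.RandomPlanarGeometry

/-- **[LSW] p. 5 result 2 (transposed), from the leaf literature facts.** See the module
docstring for the list of hypotheses; the Jordan curve theorem, arc non-separation, the Riemann
mapping theorem, simple connectivity of Jordan domains, Conway VIII.2.2 and Carathéodory's
theorem are supplied by their proofs in the tree. [cite: LawlerSchrammWerner2003Restriction, p. 5 result 2; Prop. 3.3, Thm. 6.1, Thm. 7.3, Cor. 8.6] -/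
theorem LawlerSchrammWerner2003_of_leaf_facts (hW : Process.isProjectiveLimit_preWienerMeasure)
    (h8 : hasSLETrace_eight) (hne : hasSLETrace_of_ne_eight) (htr : tendsto_norm_sleTrace_atTop)
    (hscale : identDistrib_sleTrace_scale)
    (h₆ : RandomPlanarGeometry.ae_isSimpleTrace_sleTrace_of_le_four (κ := (8 : ℝ≥0) / 3))
    (h61 : sle_restriction_eightThirds) (hexΦ : IsStarHull.existsUnique_isRestrictionMap)
    (hex : IsStarHull.exists_hasRestrictionDeriv) (hFc : HasRestrictionDeriv.tendsto_of_kernel)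
    (h21 : IsPlusHull.exists_antitone_isArcHull)
    (hfac : IsStarHull.exists_isHullProduct_plus_minus)
    (h33 : exists_isRestrictionMeasure_of_isHullMultiplicative)
    (h58 : IsRestrictionMeasure.eq_five_eighths_of_outer_simple) : LawlerSchrammWerner2003 := by
  have hC : JordanDomain.exists_continuousOn_extension :=
    JordanDomain.exists_continuousOn_extension_of_jordanCurveTheorem Literature.Topology.PlaneTopology.JordanCurveTheorem_holds
  exact LawlerSchrammWerner2003_of_uniqueness hW h8 hne htr JordanDomain.isSimplyConnected_holds
    exists_conformalEquiv_ball_holds hC hscale h₆ Literature.Topology.PlaneTopology.JordanCurveTheorem_holds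
    Literature.Topology.PlaneTopology.JordanArcSeparation_holds isSimplyConnected_of_isConnected_compl_holds h61 hexΦ hex hFc
    (LawlerSchrammWerner2003_unique_of_facts Literature.Topology.PlaneTopology.JordanCurveTheorem_holds Literature.Topology.PlaneTopology.JordanArcSeparation_holds hC
      JordanDomain.isSimplyConnected_holds exists_conformalEquiv_ball_holds hexΦ hex
      isSimplyConnected_of_isConnected_compl_holds h21 hfac h33 h58)

end Literature.Probability.RandomPlanarGeometry

end
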